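import Summits.HodgeConjecture.HodgeConjecture.Theorems.Ring2AbelianAllAndreRetractPencils
import Literature.AlgebraicGeometry.HodgeTheory.SurjectivePullbackAlgebraicClasses
import Literature.AlgebraicGeometry.HodgeTheory.SupportedClassesQuasiFinitePullback
import HarnessLib

/-!
# Ring 2 · sub-cell AbelianAll (ALL ABELIAN VARIETIES), André axis, part XXXIII-e — DOMINATED PENCILS: the André-axis statements
# DESCEND along every SURJECTIVE `S`-morphism `ψ : 𝒳 ⟶ 𝒳'` of smooth projective families of the SAME relative dimension
# (fibrewise isogenies of compact pencils of abelian varieties): transport from `t` to `s` and the lift `(L)_t(p)` for the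
# source pencil `ψ ≫ f'` give the same for the target pencil `f'`, in the same degree — fact-free (the degree trick
# `ψ_! ψ^* = c · id`, `c ≠ 0`, and one clean base change)

HONEST FRAMING (page 1, verbatim): **research route, not a corollary; conditional on HC_CM plus one named
minimal statement.** Cell line: research route conditional on HC_CM; not a corollary; Q11.4-sentence-2 already
refuted in dim ≥ 3. Nothing in this file proves a case of the Hodge conjecture for an abelian variety; `HC_CM`, `HC_AV`
do not occur; no node is born (0 `def`), no named fact is used, no `sorry`; axioms standard; nothing is claimed minimal.

## What this part does (brief (ii): the functoriality of the André axis in the pencil, completed)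

Parts XXXIII-a/b: the content of a pencil is dominated by that of every pencil of which it is an `S`-RETRACT (fibre products,
squares, constant factors), degree shifted by the codimension. Seat b05 (`isCompactAbelianPencil_familyPullback_snd`,
`standardConjectureBStar_of_familyPullback`): finite étale BASE CHANGE `S' → S`. This part adds the third move, in the fibre
direction and WITHOUT degree shift: a surjective `S`-morphism `ψ : 𝒳 ⟶ 𝒳'` between smooth projective families
`ψ ≫ f' : 𝒳 ⟶ S` and `f' : 𝒳' ⟶ S` of the same relative dimension `d` with smooth projective total spaces of the same dimension
`N` (for compact pencils of abelian varieties: a fibrewise ISOGENY over `S`).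

* §1 `isPullback_fiberι_fiberOverMap` — the fibre map `ψ_s : 𝒳_s ⟶ 𝒳'_s` (the tree's `Motives.fiberOverMap ψ f' s`) is the base
  change of `ψ` along `j'_s` (`𝒳_s = 𝒳 ×_{𝒳'} 𝒳'_s`); hence `ψ_s` is surjective (`surjective_fiberOverMap_left`) and locally
  quasi-finite when `ψ` is (`locallyQuasiFinite_fiberOverMap_left`); `dominated_incidence` — Fulton's incidence condition for
  the square.
* §2 `exists_map_fiberι_push_gysin_eq_smul` — BASE CHANGE `j'_s^* ψ_! = c · ψ_{s!} j_s^*` (the tree's PROVED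
  `complexGysin_cleanBaseChange`; expected dimensions `d + N = N + d`), so `ψ_!` maps classes dying on `𝒳_s` to classes dying on
  `𝒳'_s` (`map_fiberι_push_gysin_eq_zero`); `map_fiberι_map_mem_iff` — for every `s`, **`ψ^* W'` is algebraic on `𝒳_s` iff `W'`
  is algebraic on `𝒳'_s`** (`⟸`: pull-back along `ψ_s`, granted that `ψ_s^*` preserves algebraic classes — a hypothesis `hpull`
  of the engine, DISCHARGED for locally quasi-finite `ψ` by the tree's `map_mem_algebraicClasses_of_locallyQuasiFinite`
  (`pull_of_locallyQuasiFinite`) and for pencils with abelian fibres by the tree's `map_mem_algebraicClasses_of_abelianVariety`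
  (`pull_of_pencil`); `⟹`: the DEGREE TRICK on the fibre, the tree's `mem_algebraicClasses_of_map_mem_of_surjective` for the
  surjective equidimensional `ψ_s`): the algebraicity locus of `ψ^* W'` for `ψ ≫ f'` is that of `W'` for `f'`.
* §3 **`comap_le_comap_of_dominant`** — transport from `t` to `s` along `ψ ≫ f'` gives transport from `t` to `s` along `f'`
  (`W' ↦ ψ^* W'`, loci coincide); **`comap_le_sup_of_dominant`** — the LIFT `(L)_t(p)` of `ψ ≫ f'` gives `(L)_t(p)` of `f'`:
  `ψ^* W' = η + κ` ⟹ `c · W' = ψ_! ψ^* W' = ψ_! η + ψ_! κ` with `ψ_! η` algebraic, `ψ_! κ` dying on `𝒳'_t`, and `c ≠ 0` by the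
  tree's PROVED `exists_complexGysin_map_eq_smul_of_surjective` (Voisin I, Rem. 7.29) on the total spaces.
* §4 the same for compact pencils of abelian varieties of relative dimension `d` and a surjective `S`-morphism between them
  (`comap_le_comap_of_isogenous`, `comap_le_sup_of_isogenous`, `forall_map_fiberι_mem_of_isogenous`): nothing but surjectivity is
  asked of `ψ` (the fibres are abelian, so `ψ_s^*` preserves algebraic classes by Kleiman's moving-by-translation, the tree's
  theorem).

So the André-axis content of a pencil DOMINATES that of every pencil it maps ONTO over `S` equidimensionally, and is dominated
by that of every pencil retracting onto it (XXXIII-a): with seat b05's base change these are all the functorialities of the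
pencil the tree affords. READING (prose): up to the two moves, a compact pencil of abelian varieties may be replaced by any
isogenous one and by any fibre product containing it as a factor — e.g. (Poincaré reducibility over the generic point, NOT in
the tree) an abelian subscheme `𝒴 ⊂ 𝒳` with quasi-complement `𝒵` gives `𝒴 ×_S 𝒵 ↠ 𝒳`, so the content of `𝒳` lies between that
of its isogeny factors' fibre product and that of its retracts. What is NOT claimed: the converse descent `f' ⟹ ψ ≫ f'`
(`ψ^* ψ_!` is not a scalar); anything about CM points under `ψ` (the pointwise theorems take `t` arbitrary); anything minimal;
any case of HC. EDGE LABELS: every row K (kernel, fact-free).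

References: VoisinHodgeI2002 (§7.3.2 Lemma 7.28, Remark 7.29); Fulton1998 (Prop. 1.7, Thm. 6.2 (a), §19.2 Cor. 19.2 (b),
App. B.9.2); FultonYoungTableaux1997 (App. B §B.1 (6)–(7)); Schoen1988HodgeWeil (§3 Cor. 3.1); MumfordAV1970 (§1 (1), §19
Thm. 1 (Poincaré reducibility)); Milne2020HodgeClassesAV (Prop. 1 p. 7); Abdulali1994FamiliesAV ((1.1) p. 1122);
Andre1996Motifs (§6.3, proof of Lemme 6.3.1, p. 32: «bouger s ou t par G(ℚ) change X_s, X_t en des variétés abéliennes isogènes»); DeligneHodgeII1971 (proof of Lemme 4.4.16, p. 53: «remplaçant X par un schéma abélien isogène»);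
GrothendieckTopology1969 (§1). [Locators revised after REFEREE-AB F-ab-138 / F-ab-142: §5.1 p. 25 of Andre1996Motifs concerns replacing the BASE `S` by a smooth affine curve `S′ → S` through `s, t` (the finite-étale licence is §5.3 p. 30; F-ab-145), not the abelian scheme by an isogenous one; the «schéma abélien isogène» sentence is Deligne's.]
-/

noncomputable section

set_option linter.dupNamespace false

namespace Summit.HodgeConjecture.HodgeConjecture.Ring2.AbelianAll

open CategoryTheory CategoryTheory.Limits AlgebraicGeometry MonoidalCategory CartesianMonoidalCategory
open Literature.AlgebraicGeometry Literature.AlgebraicGeometry.Motives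
open Literature.AlgebraicGeometry.HodgeTheory

variable {𝒳 𝒳' S : SchemeOver ℂ}

/-! ## §1 The fibre map of an `S`-morphism is a base change of it -/

/-- **`𝒳_s = 𝒳 ×_{𝒳'} 𝒳'_s`**: for `ψ : 𝒳 ⟶ 𝒳'` and the family `f' : 𝒳' ⟶ S`, the square `𝒳_s ⟶ 𝒳` (fibre inclusion of
`ψ ≫ f'`) over `𝒳'_s ⟶ 𝒳'`, with the fibre map `ψ_s = fiberOverMap ψ f' s` on the left and `ψ` on the right, is cartesian
(cancel the fibre square of `f'` from the fibre square of `ψ ≫ f'`). [cite: Hartshorne1977, II.3 (p. 89)] [cite: Fulton1998, §10.1] -/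
theorem isPullback_fiberι_fiberOverMap (f' : 𝒳' ⟶ S) (ψ : 𝒳 ⟶ 𝒳') (s : ComplexPoints S) :
    IsPullback (fiberι (ψ ≫ f') s) (fiberOverMap ψ f' s) ψ (fiberι f' s) := by
  have h' : IsPullback (fiberι f' s) (fiberOverToSpec f' s) f' s := familyPullback.isPullback f' s
  have h : IsPullback (fiberι (ψ ≫ f') s) (fiberOverToSpec (ψ ≫ f') s) (ψ ≫ f') s := familyPullback.isPullback (ψ ≫ f') s
  refine IsPullback.of_bot (t := h') ?_ (fiberOverMap_comp_fiberι ψ f' s).symm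
  rw [Motives.eq_toSpecOver (fiberOverMap ψ f' s ≫ fiberOverToSpec f' s), ← Motives.eq_toSpecOver (fiberOverToSpec (ψ ≫ f') s)]
  exact h

/-- The fibre map of a surjective `S`-morphism is surjective. [folklore] -/
theorem surjective_fiberOverMap_left (f' : 𝒳' ⟶ S) (ψ : 𝒳 ⟶ 𝒳') [Surjective ψ.left] (s : ComplexPoints S) :
    Surjective (fiberOverMap ψ f' s).left :=
  MorphismProperty.of_isPullback (P := @Surjective) ((isPullback_fiberι_fiberOverMap f' ψ s).map (Over.forget _))
    ‹Surjective ψ.left›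

/-- The fibre map of a locally quasi-finite `S`-morphism is locally quasi-finite. [folklore] -/
theorem locallyQuasiFinite_fiberOverMap_left (f' : 𝒳' ⟶ S) (ψ : 𝒳 ⟶ 𝒳') [LocallyQuasiFinite ψ.left]
    (s : ComplexPoints S) : LocallyQuasiFinite (fiberOverMap ψ f' s).left :=
  MorphismProperty.of_isPullback (P := @LocallyQuasiFinite)
    ((isPullback_fiberι_fiberOverMap f' ψ s).map (Over.forget _)) ‹LocallyQuasiFinite ψ.left›

/-- **Incidence for the square of §1**: a point `P` of `𝒳` with `ψ(P) = j'_s(Q)` lies over `s`, i.e. `P = j_s(R)` with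
`ψ_s(R) = Q`. [cite: Fulton1998, Thm. 6.2 (a)] -/
theorem dominated_incidence [IsSeparated S.hom] (f' : 𝒳' ⟶ S) (ψ : 𝒳 ⟶ 𝒳') (s : ComplexPoints S) (P : ComplexPoints 𝒳)
    (Q : ComplexPoints (fiberOver f' s)) (hPQ : AlgPoints.map ψ P = AlgPoints.map (fiberι f' s) Q) :
    ∃ R : ComplexPoints (fiberOver (ψ ≫ f') s),
      AlgPoints.map (fiberι (ψ ≫ f') s) R = P ∧ AlgPoints.map (fiberOverMap ψ f' s) R = Q := by
  haveI : IsClosedImmersion (fiberι f' s).left := by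
    haveI : IsClosedImmersion s.left := Motives.CurveNet.isClosedImmersion_left_of_isSeparated s
    rw [fiberι_left]
    exact MorphismProperty.pullback_fst (P := @IsClosedImmersion) _ _ inferInstance
  have hs : P ∈ AlgPoints.map (ψ ≫ f') ⁻¹' {s} := by
    change AlgPoints.map (ψ ≫ f') P = s
    rw [AlgPoints.map_comp_apply, hPQ, AlgPoints.map_map_fiberι]
  rw [← AlgPoints.range_map_fiberι] at hs
  obtain ⟨R, hR⟩ := hs
  refine ⟨R, hR, AlgPoints.map_injective (fiberι f' s) ?_⟩
  rw [AlgPoints.map_fiberι_map_fiberOverMap, hR, hPQ]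

/-! ## §2 The push-forward `ψ_!` along a dominant `S`-morphism of smooth projective families of the same dimension -/

section Engine

variable {N d : ℕ} {f' : 𝒳' ⟶ S} {ψ : 𝒳 ⟶ 𝒳'} (μ : OrientationFamily) (hX : IsSmoothProjective N 𝒳)
  (hX' : IsSmoothProjective N 𝒳') (hf : IsSmoothProjectiveFamily (ψ ≫ f') d) (hf' : IsSmoothProjectiveFamily f' d)

/-- `j_s^* ψ^* = ψ_s^* j'_s^*` on cohomology (naturality of the fibre inclusions). [folklore] -/
theorem map_fiberι_map_eq (s : ComplexPoints S) (k : ℕ) (W' : complexBetti 𝒳' k) :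
    complexBetti.map (fiberι (ψ ≫ f') s) k (complexBetti.map ψ k W') =
      complexBetti.map (fiberOverMap ψ f' s) k (complexBetti.map (fiberι f' s) k W') := by
  rw [← complexBetti.map_comp_apply', ← complexBetti.map_comp_apply', fiberOverMap_comp_fiberι]

variable [IsSeparated S.hom]

include hf hf' in
/-- **Base change for the push-forward** (the cartesian square of §1, of the expected dimensions `d + N = N + d`): restricting
`ψ_! u` to `𝒳'_s` is, up to ONE scalar, `ψ_{s!}(j_s^* u)` — the tree's PROVED `complexGysin_cleanBaseChange`.
[cite: Fulton1998, Thm. 6.2 (a) and Prop. 1.7] -/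
theorem exists_map_fiberι_push_gysin_eq_smul (s : ComplexPoints S) :
    ∃ c : ℂ, ∀ ⦃k k₁ : ℕ⦄ (hk : k + 2 * N = k₁ + 2 * N) (u : complexBetti 𝒳 k),
      complexBetti.map (fiberι f' s) k₁ (complexGysin μ hX hX' ψ hk u) =
        c • complexGysin μ (hf.isSmoothProjective s) (hf'.isSmoothProjective s) (fiberOverMap ψ f' s)
          (show k + 2 * d = k₁ + 2 * d by omega) (complexBetti.map (fiberι (ψ ≫ f') s) k u) := by
  haveI : IsClosedImmersion (fiberι (ψ ≫ f') s).left := by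
    haveI : IsClosedImmersion s.left := Motives.CurveNet.isClosedImmersion_left_of_isSeparated s
    rw [fiberι_left]
    exact MorphismProperty.pullback_fst (P := @IsClosedImmersion) _ _ inferInstance
  haveI := isClosedImmersion_lift_left_of_isSmoothProjective (hf'.isSmoothProjective s) (fiberι (ψ ≫ f') s)
    (fiberOverMap ψ f' s)
  exact complexGysin_cleanBaseChange μ hX hX' (hf'.isSmoothProjective s) (hf.isSmoothProjective s) ψ (fiberι f' s)
    (fiberι (ψ ≫ f') s) (fiberOverMap ψ f' s) (by omega) (dominated_incidence f' ψ s)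

include hf hf' in
/-- `ψ_!` maps the classes dying on `𝒳_s` into the classes dying on `𝒳'_s`. [cite: Fulton1998, Thm. 6.2 (a)] -/
theorem map_fiberι_push_gysin_eq_zero (s : ComplexPoints S) {k k₁ : ℕ} (hk : k + 2 * N = k₁ + 2 * N)
    {u : complexBetti 𝒳 k} (hu : complexBetti.map (fiberι (ψ ≫ f') s) k u = 0) :
    complexBetti.map (fiberι f' s) k₁ (complexGysin μ hX hX' ψ hk u) = 0 := by
  obtain ⟨c, hc⟩ := exists_map_fiberι_push_gysin_eq_smul μ hX hX' hf hf' s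
  rw [hc hk u, hu, map_zero, smul_zero]

include hf hf' in
omit [IsSeparated S.hom] in
/-- **THE TWO ALGEBRAICITY LOCI COINCIDE**: for `ψ` surjective and every `s`, `ψ^* W'` is algebraic on `𝒳_s` iff `W'` is
algebraic on `𝒳'_s`, granted that the fibre map `ψ_s^*` preserves algebraic classes (`hpull`; discharged below for locally
quasi-finite `ψ` and for abelian fibres). `⟹` is the degree trick on the fibre: `ψ_s` is surjective between smooth projective
varieties of the same dimension `d`, so `ψ_s^* y` algebraic ⟹ `y` algebraic (the tree's `mem_algebraicClasses_of_map_mem_of_surjective`).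
[cite: VoisinHodgeI2002, §7.3.2 Remark 7.29] [cite: Fulton1998, §19.2 Cor. 19.2 (b)] -/
theorem map_fiberι_map_mem_iff [Surjective ψ.left] (s : ComplexPoints S) (p : ℕ)
    (hpull : ∀ y ∈ algebraicClasses (fiberOver f' s) p,
      complexBetti.map (fiberOverMap ψ f' s) (2 * p) y ∈ algebraicClasses (fiberOver (ψ ≫ f') s) p)
    (W' : complexBetti 𝒳' (2 * p)) :
    complexBetti.map (fiberι (ψ ≫ f') s) (2 * p) (complexBetti.map ψ (2 * p) W') ∈ algebraicClasses (fiberOver (ψ ≫ f') s) p ↔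
      complexBetti.map (fiberι f' s) (2 * p) W' ∈ algebraicClasses (fiberOver f' s) p := by
  rw [map_fiberι_map_eq]
  refine ⟨fun h ↦ ?_, hpull _⟩
  haveI := surjective_fiberOverMap_left f' ψ s
  exact mem_algebraicClasses_of_map_mem_of_surjective (hf.isSmoothProjective s) (hf'.isSmoothProjective s)
    (fiberOverMap ψ f' s) h

include hf hf' in
omit [IsSeparated S.hom] in
/-- DISCHARGE of `hpull` for a locally quasi-finite `ψ` (e.g. a fibrewise isogeny): `ψ_s` is locally quasi-finite between smooth
projective varieties, so `ψ_s^*` preserves algebraic classes (the tree's `map_mem_algebraicClasses_of_locallyQuasiFinite`).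
[cite: Fulton1998, §19.2 Cor. 19.2 (b) and §1.7] [cite: GrothendieckTopology1969, §1] -/
theorem pull_of_locallyQuasiFinite [LocallyQuasiFinite ψ.left] (s : ComplexPoints S) (p : ℕ) :
    ∀ y ∈ algebraicClasses (fiberOver f' s) p,
      complexBetti.map (fiberOverMap ψ f' s) (2 * p) y ∈ algebraicClasses (fiberOver (ψ ≫ f') s) p := by
  intro y hy
  haveI := locallyQuasiFinite_fiberOverMap_left f' ψ s
  exact map_mem_algebraicClasses_of_locallyQuasiFinite (hf.isSmoothProjective s) (hf'.isSmoothProjective s)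
    (fiberOverMap ψ f' s) hy

end Engine

/-! ## §3 Pointwise consequences: transport and lift descend from `ψ ≫ f'` to `f'` -/

section Pointwise

variable {N d : ℕ} {f' : 𝒳' ⟶ S} {ψ : 𝒳 ⟶ 𝒳'} (hX : IsSmoothProjective N 𝒳) (hX' : IsSmoothProjective N 𝒳')
  (hf : IsSmoothProjectiveFamily (ψ ≫ f') d) (hf' : IsSmoothProjectiveFamily f' d)

variable [IsSeparated S.hom] [Surjective ψ.left]

omit [IsSeparated S.hom] in
include hf hf' in
/-- **TRANSPORT DESCENDS along a surjective equidimensional `S`-morphism**: if every class of `𝒳` of degree `2p` algebraic on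
`𝒳_t` is algebraic on `𝒳_s`, then every class of `𝒳'` of degree `2p` algebraic on `𝒳'_t` is algebraic on `𝒳'_s` (`W' ↦ ψ^* W'`,
loci coincide), granted `hpull` at `t`. FACT-FREE. [cite: Abdulali1994FamiliesAV, (1.1) (p. 1122)] [cite: VoisinHodgeI2002, §7.3.2 Remark 7.29] -/
theorem comap_le_comap_of_dominant {t s : ComplexPoints S} {p : ℕ}
    (hpull : ∀ y ∈ algebraicClasses (fiberOver f' t) p,
      complexBetti.map (fiberOverMap ψ f' t) (2 * p) y ∈ algebraicClasses (fiberOver (ψ ≫ f') t) p)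
    (h : (algebraicClasses (fiberOver (ψ ≫ f') t) p).comap (complexBetti.map (fiberι (ψ ≫ f') t) (2 * p)).hom ≤
      (algebraicClasses (fiberOver (ψ ≫ f') s) p).comap (complexBetti.map (fiberι (ψ ≫ f') s) (2 * p)).hom) :
    (algebraicClasses (fiberOver f' t) p).comap (complexBetti.map (fiberι f' t) (2 * p)).hom ≤
      (algebraicClasses (fiberOver f' s) p).comap (complexBetti.map (fiberι f' s) (2 * p)).hom := by
  intro W' hW'
  have hWt : complexBetti.map ψ (2 * p) W' ∈
      (algebraicClasses (fiberOver (ψ ≫ f') t) p).comap (complexBetti.map (fiberι (ψ ≫ f') t) (2 * p)).hom := by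
    change complexBetti.map (fiberι (ψ ≫ f') t) (2 * p) (complexBetti.map ψ (2 * p) W') ∈
      algebraicClasses (fiberOver (ψ ≫ f') t) p
    rw [map_fiberι_map_eq]
    exact hpull _ hW'
  have h₁ : complexBetti.map (fiberι (ψ ≫ f') s) (2 * p) (complexBetti.map ψ (2 * p) W') ∈
      algebraicClasses (fiberOver (ψ ≫ f') s) p := h hWt
  haveI := surjective_fiberOverMap_left f' ψ s
  rw [map_fiberι_map_eq] at h₁
  exact mem_algebraicClasses_of_map_mem_of_surjective (hf.isSmoothProjective s) (hf'.isSmoothProjective s)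
    (fiberOverMap ψ f' s) h₁

include hX hX' hf hf' in
/-- **THE LIFT DESCENDS along a surjective equidimensional `S`-morphism**: `(L)_t(p)` for `ψ ≫ f'` gives `(L)_t(p)` for `f'`,
granted `hpull` at `t`: for `W'` algebraic on `𝒳'_t`, `ψ^* W'` is algebraic on `𝒳_t`, so `ψ^* W' = η + κ` with `η` algebraic on
`𝒳`, `κ` dying on `𝒳_t`; then `c · W' = ψ_! ψ^* W' = ψ_! η + ψ_! κ` with `ψ_! η` algebraic, `ψ_! κ` dying on `𝒳'_t` (base change)
and `c ≠ 0` (the degree trick on the total spaces, the tree's `exists_complexGysin_map_eq_smul_of_surjective`). FACT-FREE.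
[cite: VoisinHodgeI2002, §7.3.2 Remark 7.29] [cite: Milne2020HodgeClassesAV, Prop. 1 (p. 7)] [cite: Fulton1998, Thm. 6.2 (a)] -/
theorem comap_le_sup_of_dominant {t : ComplexPoints S} {p : ℕ}
    (hpull : ∀ y ∈ algebraicClasses (fiberOver f' t) p,
      complexBetti.map (fiberOverMap ψ f' t) (2 * p) y ∈ algebraicClasses (fiberOver (ψ ≫ f') t) p)
    (h : (algebraicClasses (fiberOver (ψ ≫ f') t) p).comap (complexBetti.map (fiberι (ψ ≫ f') t) (2 * p)).hom ≤
      algebraicClasses 𝒳 p ⊔ LinearMap.ker (complexBetti.map (fiberι (ψ ≫ f') t) (2 * p)).hom) :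
    (algebraicClasses (fiberOver f' t) p).comap (complexBetti.map (fiberι f' t) (2 * p)).hom ≤
      algebraicClasses 𝒳' p ⊔ LinearMap.ker (complexBetti.map (fiberι f' t) (2 * p)).hom := by
  intro W' hW'
  let μ : OrientationFamily := fun _ _ h ↦ (Motives.ComplexPoints.isOrientableOver ℂ h).some
  have hWt : complexBetti.map ψ (2 * p) W' ∈
      (algebraicClasses (fiberOver (ψ ≫ f') t) p).comap (complexBetti.map (fiberι (ψ ≫ f') t) (2 * p)).hom := by
    change complexBetti.map (fiberι (ψ ≫ f') t) (2 * p) (complexBetti.map ψ (2 * p) W') ∈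
      algebraicClasses (fiberOver (ψ ≫ f') t) p
    rw [map_fiberι_map_eq]
    exact hpull _ hW'
  obtain ⟨η, hη, κ, hκ, hsum⟩ := Submodule.mem_sup.1 (h hWt)
  obtain ⟨c, hc, hcid⟩ := exists_complexGysin_map_eq_smul_of_surjective μ hX hX' ψ
  have hcW : c • W' = complexGysin μ hX hX' ψ rfl η + complexGysin μ hX hX' ψ rfl κ := by
    rw [← hcid (2 * p) rfl W', ← hsum, map_add]
  have hW'eq : W' = c⁻¹ • (complexGysin μ hX hX' ψ rfl η + complexGysin μ hX hX' ψ rfl κ) := by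
    rw [← hcW, smul_smul, inv_mul_cancel₀ hc, one_smul]
  rw [hW'eq]
  refine Submodule.smul_mem _ _ (Submodule.add_mem_sup ?_ ?_)
  · exact complexGysin_mem_algebraicClasses_of_mem_algebraicClasses μ hX hX' ψ _ hη
  · rw [LinearMap.mem_ker] at hκ ⊢
    exact map_fiberι_push_gysin_eq_zero μ hX hX' hf hf' t _ hκ

omit [IsSeparated S.hom] in
include hf hf' in
/-- **The single-class transport form**: if every class of `𝒳` of degree `2p` algebraic on `𝒳_t` is algebraic on all fibres of
`ψ ≫ f'`, then every class of `𝒳'` of degree `2p` algebraic on `𝒳'_t` is algebraic on all fibres of `f'`. FACT-FREE.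
[cite: Abdulali1994FamiliesAV, (1.1) (p. 1122)] -/
theorem forall_map_fiberι_mem_of_dominant {t : ComplexPoints S} {p : ℕ}
    (hpull : ∀ y ∈ algebraicClasses (fiberOver f' t) p,
      complexBetti.map (fiberOverMap ψ f' t) (2 * p) y ∈ algebraicClasses (fiberOver (ψ ≫ f') t) p)
    (h : ∀ U : complexBetti 𝒳 (2 * p),
      complexBetti.map (fiberι (ψ ≫ f') t) (2 * p) U ∈ algebraicClasses (fiberOver (ψ ≫ f') t) p →
        ∀ s : ComplexPoints S, complexBetti.map (fiberι (ψ ≫ f') s) (2 * p) U ∈ algebraicClasses (fiberOver (ψ ≫ f') s) p)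
    (W' : complexBetti 𝒳' (2 * p)) (hW' : complexBetti.map (fiberι f' t) (2 * p) W' ∈ algebraicClasses (fiberOver f' t) p)
    (s : ComplexPoints S) : complexBetti.map (fiberι f' s) (2 * p) W' ∈ algebraicClasses (fiberOver f' s) p :=
  comap_le_comap_of_dominant hf hf' (t := t) (s := s) (p := p) hpull (fun U hU ↦ h U hU s) hW'

end Pointwise

/-! ## §4 Compact pencils of abelian varieties: a surjective `S`-morphism of pencils of the same relative dimension -/

section Pencils

variable {d : ℕ} {f' : 𝒳' ⟶ S} {ψ : 𝒳 ⟶ 𝒳'} (hf : IsCompactAbelianPencil (ψ ≫ f') d) (hf' : IsCompactAbelianPencil f' d)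

include hf hf' in
/-- DISCHARGE of `hpull` for compact pencils of abelian varieties, with NOTHING asked of `ψ`: the fibre `𝒳'_t` is an abelian
variety (up to the chart `e : A.X ≅ 𝒳'_t`), and pull-back along ANY morphism from a smooth projective variety to an abelian
variety preserves algebraic classes (the tree's `map_mem_algebraicClasses_of_abelianVariety`, moving by translations).
[cite: Fulton1998, §19.2 Cor. 19.2 (b) and Appendix B.9.2 (a)] [cite: MumfordAV1970, §1 (1)] -/
theorem pull_of_pencil (t : ComplexPoints S) (p : ℕ) :
    ∀ y ∈ algebraicClasses (fiberOver f' t) p,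
      complexBetti.map (fiberOverMap ψ f' t) (2 * p) y ∈ algebraicClasses (fiberOver (ψ ≫ f') t) p := by
  intro y hy
  obtain ⟨A, ⟨e⟩⟩ := hf'.exists_abelianVariety_fiber t
  have hy' : complexBetti.map e.hom (2 * p) y ∈ algebraicClasses A.X p := (mem_algebraicClasses_map_iff_of_iso e).2 hy
  have h := map_mem_algebraicClasses_of_abelianVariety (hf.isSmoothProjective_fiberOver t) A (fiberOverMap ψ f' t ≫ e.inv) hy'
  rwa [← complexBetti.map_comp_apply', Category.assoc, e.inv_hom_id, Category.comp_id] at h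

variable [Surjective ψ.left]

include hf hf' in
/-- **TRANSPORT DESCENDS ALONG SURJECTIVE `S`-MORPHISMS OF COMPACT ABELIAN PENCILS of the same relative dimension** (fibrewise
isogenies): transport from `t` to `s` in degree `2p` along `ψ ≫ f'` gives it along `f'`. FACT-FREE.
[cite: Abdulali1994FamiliesAV, (1.1) (p. 1122)] [cite: Andre1996Motifs, §6.3 proof of Lemme 6.3.1 (p. 32)] [cite: VoisinHodgeI2002, §7.3.2 Remark 7.29] -/
theorem comap_le_comap_of_isogenous {t s : ComplexPoints S} {p : ℕ}
    (h : (algebraicClasses (fiberOver (ψ ≫ f') t) p).comap (complexBetti.map (fiberι (ψ ≫ f') t) (2 * p)).hom ≤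
      (algebraicClasses (fiberOver (ψ ≫ f') s) p).comap (complexBetti.map (fiberι (ψ ≫ f') s) (2 * p)).hom) :
    (algebraicClasses (fiberOver f' t) p).comap (complexBetti.map (fiberι f' t) (2 * p)).hom ≤
      (algebraicClasses (fiberOver f' s) p).comap (complexBetti.map (fiberι f' s) (2 * p)).hom := by
  exact comap_le_comap_of_dominant hf.isSmoothProjectiveFamily hf'.isSmoothProjectiveFamily (pull_of_pencil hf hf' t p) h

include hf hf' in
/-- **THE LIFT DESCENDS ALONG SURJECTIVE `S`-MORPHISMS OF COMPACT ABELIAN PENCILS of the same relative dimension**: `(L)_t(p)` for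
`ψ ≫ f'` gives `(L)_t(p)` for `f'` (same point, same degree). FACT-FREE. [cite: Milne2020HodgeClassesAV, Prop. 1 (p. 7)]
[cite: Andre1996Motifs, §6.3 proof of Lemme 6.3.1 (p. 32)] [cite: VoisinHodgeI2002, §7.3.2 Remark 7.29] -/
theorem comap_le_sup_of_isogenous {t : ComplexPoints S} {p : ℕ}
    (h : (algebraicClasses (fiberOver (ψ ≫ f') t) p).comap (complexBetti.map (fiberι (ψ ≫ f') t) (2 * p)).hom ≤
      algebraicClasses 𝒳 p ⊔ LinearMap.ker (complexBetti.map (fiberι (ψ ≫ f') t) (2 * p)).hom) :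
    (algebraicClasses (fiberOver f' t) p).comap (complexBetti.map (fiberι f' t) (2 * p)).hom ≤
      algebraicClasses 𝒳' p ⊔ LinearMap.ker (complexBetti.map (fiberι f' t) (2 * p)).hom := by
  haveI : IsProper S.hom := IsSmoothProjective.isProper_holds hf.isSmoothProjective_base
  exact comap_le_sup_of_dominant hf.isSmoothProjective_total hf'.isSmoothProjective_total hf.isSmoothProjectiveFamily
    hf'.isSmoothProjectiveFamily (pull_of_pencil hf hf' t p) h

include hf hf' in
/-- The single-class transport form for compact abelian pencils. FACT-FREE. [cite: Abdulali1994FamiliesAV, (1.1) (p. 1122)] -/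
theorem forall_map_fiberι_mem_of_isogenous {t : ComplexPoints S} {p : ℕ}
    (h : ∀ U : complexBetti 𝒳 (2 * p),
      complexBetti.map (fiberι (ψ ≫ f') t) (2 * p) U ∈ algebraicClasses (fiberOver (ψ ≫ f') t) p →
        ∀ s : ComplexPoints S, complexBetti.map (fiberι (ψ ≫ f') s) (2 * p) U ∈ algebraicClasses (fiberOver (ψ ≫ f') s) p)
    (W' : complexBetti 𝒳' (2 * p)) (hW' : complexBetti.map (fiberι f' t) (2 * p) W' ∈ algebraicClasses (fiberOver f' t) p)
    (s : ComplexPoints S) : complexBetti.map (fiberι f' s) (2 * p) W' ∈ algebraicClasses (fiberOver f' s) p :=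
  comap_le_comap_of_isogenous hf hf' (t := t) (s := s) (p := p) (fun U hU ↦ h U hU s) hW'

end Pencils

end Summit.HodgeConjecture.HodgeConjecture.Ring2.AbelianAll

end
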